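import Mathlib.LinearAlgebra.Matrix.Symmetric
import Mathlib.LinearAlgebra.Matrix.BilinearForm
import Mathlib.LinearAlgebra.Reflection
import Mathlib.Data.Matrix.Mul
import HarnessLib

/-!
# Reflection matrices of a symmetric "doubled Gram" matrix

For a symmetric matrix `T` over a commutative ring `R` with `T_{ss} = 2` — twice a Gram matrix
`B(α_i, α_j)` with `B(α_s, α_s) = 1`, as for the canonical form of a Coxeter group (Humphreys,
*Reflection Groups and Coxeter Groups* (1990), §5.3: `σ_s λ = λ - 2B(α_s, λ)α_s` "preserves the
form `B`" and "has order 2") — the matrix of the reflection `x ↦ x - 2B(α_s, x) α_s = x - ⟨T_s, x⟩ e_s`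
is `S_s = 1 - e_s ⊗ T_s`. Working with `T = 2B` keeps all entries in `R` (no division by `2`), which is
the point for INTEGRAL reflection groups such as `[5,3,3,5] ≤ GL₅(ℤ[φ])`
(`Literature/Geometry/Hyperbolic/Coxeter5335*.lean`).

**Relation to Mathlib.** This is the explicit-matrix specialisation of Mathlib's
`Module.preReflection x f` (`y ↦ y - f y • x`, `Mathlib/LinearAlgebra/Reflection.lean`) with
`x = Pi.single s 1` and `f = ⟨T_s, ·⟩ = proj s ∘ toLin' T`: the bridge is `toLin'_reflMatrix`, and
`reflMatrix_mul_self` (`S_s² = 1`) is DERIVED from `Module.involutive_preReflection`. We keep an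
explicit matrix (rather than `Module.reflection`, a linear equivalence, or
`LinearMap.IsReflective` of `Mathlib/LinearAlgebra/RootSystem/OfBilinear.lean`, which needs `2`
regular / a reflexive module, or the field-only `Literature.LinearAlgebra.QuadraticForm.reflection`
of `CartanDieudonne.lean`) because the downstream use is arithmetic: the ENTRIES of `S_s` over
`ℤ[φ]`, their images under ring homomorphisms (`reflMatrix_map`, real/Galois-conjugate embeddings and
reduction mod `p`), membership of products in `GL₅(ℤ[φ])` as `Matrix`-units, and `decide`-style
entrywise identities — all of which want a `Matrix n n R` over an arbitrary commutative ring with no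
hypothesis on `2`. The isometry statement `S_sᵀ T S_s = T` is proved directly for the same reason.
We prove:

* `reflMatrix T s` (`(S_s)_{ij} = δ_{ij} - δ_{is} T_{sj}`), `reflMatrix_mulVec` (`S_s x = x - ⟨T_s,x⟩ e_s`),
  `toLin'_reflMatrix` (bridge to `Module.preReflection`);
* `reflMatrix_mul_self` — **`S_s² = 1`** (`T_{ss} = 2`, from `Module.involutive_preReflection`), `reflMatrixUnit`;
* `transpose_reflMatrix_mul_mul` — **`S_sᵀ T S_s = T`** for symmetric `T` (the reflection is a
  `B`-isometry); `toBilin'_mulVec_mulVec` — any `A` with `Aᵀ T A = T` preserves `(x, y) ↦ xᵀ T y`;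
* `reflMatrix_map` — compatibility with ring homomorphisms (real and conjugate embeddings).

Everything is proved; no named facts.

## References

* J. E. Humphreys, *Reflection Groups and Coxeter Groups*, CUP 1990, §5.3. [`Humphreys1990`]
-/

namespace Literature.LinearAlgebra.Matrix

open Matrix Finset

variable {R : Type*} [CommRing R] {n : Type*} [DecidableEq n] (T : Matrix n n R)

/-- The reflection matrix `S_s = 1 - e_s ⊗ T_s` of the `s`-th basis vector for the symmetric matrix
`T = 2B` (twice a Gram matrix with `B(α_s, α_s) = 1`): `S_s x = x - ⟨T_s, x⟩ e_s`, i.e.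
`x ↦ x - 2B(α_s, x) α_s`; entries `(S_s)_{ij} = δ_{ij} - δ_{is} T_{sj}` (Humphreys 1990, §5.3,
`σ_s`, in matrix form for `T = 2B`). [cite: Humphreys1990, §5.3] -/
def reflMatrix (s : n) : Matrix n n R :=
  Matrix.of fun i j ↦ (if i = j then 1 else 0) - (if i = s then T s j else 0)

/-- Entries of `S_s`. [cite: Humphreys1990, §5.3] -/
theorem reflMatrix_apply (s i j : n) :
    reflMatrix T s i j = (if i = j then 1 else 0) - (if i = s then T s j else 0) := rfl


/-- Rows other than `s` are those of the identity. [cite: Humphreys1990, §5.3] -/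
theorem reflMatrix_apply_of_ne {s i : n} (h : i ≠ s) (j : n) :
    reflMatrix T s i j = if i = j then 1 else 0 := by
  rw [reflMatrix_apply, if_neg h, sub_zero]

/-- Row `s`: `(S_s)_{sj} = δ_{sj} - T_{sj}`. [cite: Humphreys1990, §5.3] -/
theorem reflMatrix_apply_self (s j : n) :
    reflMatrix T s s j = (if s = j then 1 else 0) - T s j := by
  rw [reflMatrix_apply, if_pos rfl]

variable [Fintype n]

/-- Action on vectors: `S_s x = x - (Σ_j T_{sj} x_j) e_s` ("`σ_s λ = λ - 2B(α_s, λ)α_s`"). [cite: Humphreys1990, §5.3] -/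
theorem reflMatrix_mulVec (s : n) (x : n → R) :
    (reflMatrix T s).mulVec x = x - (∑ j, T s j * x j) • Pi.single s 1 := by
  ext i
  simp only [Matrix.mulVec, dotProduct, reflMatrix_apply, sub_mul, Finset.sum_sub_distrib,
    Pi.sub_apply, Pi.smul_apply, smul_eq_mul]
  congr 1
  · simp [Finset.sum_ite_eq]
  · by_cases h : i = s
    · subst h; simp
    · simp [h]

/-- **Bridge to Mathlib**: the linear map of `S_s` is `Module.preReflection (e_s) ⟨T_s, ·⟩`,
`y ↦ y - ⟨T_s, y⟩ e_s`, with `⟨T_s, ·⟩ = proj_s ∘ (T·)`. [cite: Humphreys1990, §5.3] -/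
theorem toLin'_reflMatrix (s : n) :
    Matrix.toLin' (reflMatrix T s) =
      Module.preReflection (Pi.single s 1) ((LinearMap.proj s).comp (Matrix.toLin' T)) := by
  refine LinearMap.ext fun x ↦ ?_
  rw [Matrix.toLin'_apply, reflMatrix_mulVec, Module.preReflection_apply, LinearMap.comp_apply,
    Matrix.toLin'_apply, LinearMap.proj_apply]
  rfl

/-- The linear form `⟨T_s, ·⟩` takes the value `T_{ss}` at `e_s`. [folklore] -/
theorem proj_comp_toLin'_single (s : n) :
    ((LinearMap.proj s).comp (Matrix.toLin' T) : (n → R) →ₗ[R] R) (Pi.single s 1) = T s s := by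
  rw [LinearMap.comp_apply, Matrix.toLin'_apply, Matrix.mulVec_single_one, LinearMap.proj_apply,
    Matrix.col_apply]

variable {T}

/-- **`S_s` is an involution** when `T_{ss} = 2` ("`σ_s` has order 2 in `GL(V)`"); derived from
Mathlib's `Module.involutive_preReflection` through `toLin'_reflMatrix`. [cite: Humphreys1990, §5.3] -/
theorem reflMatrix_mul_self {s : n} (hs : T s s = 2) : reflMatrix T s * reflMatrix T s = 1 := by
  have h2 : ((LinearMap.proj s).comp (Matrix.toLin' T) : (n → R) →ₗ[R] R) (Pi.single s 1) = 2 := by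
    rw [proj_comp_toLin'_single, hs]
  have hinv := Module.involutive_preReflection (x := Pi.single s (1 : R))
    (f := (LinearMap.proj s).comp (Matrix.toLin' T)) h2
  apply Matrix.toLin'.injective
  rw [Matrix.toLin'_mul, toLin'_reflMatrix, Matrix.toLin'_one]
  exact LinearMap.ext fun y ↦ hinv y

/-- `S_s` is invertible (its own inverse). [cite: Humphreys1990, §5.3] -/
def reflMatrixUnit {s : n} (hs : T s s = 2) : (Matrix n n R)ˣ :=
  ⟨reflMatrix T s, reflMatrix T s, reflMatrix_mul_self hs, reflMatrix_mul_self hs⟩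

/-- The unit `S_s` as a matrix. [folklore] -/
@[simp] theorem coe_reflMatrixUnit {s : n} (hs : T s s = 2) :
    ((reflMatrixUnit hs : (Matrix n n R)ˣ) : Matrix n n R) = reflMatrix T s := rfl

/-- `(T S_s)_{ij} = T_{ij} - T_{is} T_{sj}`. [cite: Humphreys1990, §5.3] -/
theorem mul_reflMatrix_apply (s i j : n) :
    (T * reflMatrix T s) i j = T i j - T i s * T s j := by
  rw [Matrix.mul_apply]
  have : ∀ k, T i k * reflMatrix T s k j =
      T i k * (if k = j then 1 else 0) - (if k = s then T i s * T s j else 0) := fun k ↦ by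
    rw [reflMatrix_apply, mul_sub]
    congr 1
    by_cases hk : k = s
    · subst hk; simp
    · simp [hk]
  simp only [this, Finset.sum_sub_distrib, mul_ite, mul_one, mul_zero, Finset.sum_ite_eq',
    Finset.mem_univ, if_true]

/-- **`S_s` preserves the form `T`**: `S_sᵀ T S_s = T` for symmetric `T` with `T_{ss} = 2`
(`x ↦ x - 2B(α_s, x)α_s` is a `B`-isometry: "`σ_s` preserves the form `B`"). [cite: Humphreys1990, §5.3] -/
theorem transpose_reflMatrix_mul_mul (hT : T.IsSymm) {s : n} (hs : T s s = 2) :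
    (reflMatrix T s).transpose * T * reflMatrix T s = T := by
  rw [Matrix.mul_assoc]
  ext i j
  rw [Matrix.mul_apply]
  simp only [Matrix.transpose_apply, mul_reflMatrix_apply]
  -- Σ_k S k i * (T k j - T k s * T s j): k = i term plus k = s term
  have hk : ∀ k, reflMatrix T s k i * (T k j - T k s * T s j) =
      (if k = i then T i j - T i s * T s j else 0) -
        (if k = s then T s i * (T s j - T s s * T s j) else 0) := fun k ↦ by
    rw [reflMatrix_apply, sub_mul]
    congr 1
    · by_cases h : k = i
      · subst h; simp
      · simp [h]
    · by_cases h : k = s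
      · subst h; simp
      · simp [h]
  simp only [hk, Finset.sum_sub_distrib, Finset.sum_ite_eq', Finset.mem_univ, if_true, hs]
  have hsym : T i s = T s i := hT.apply s i
  rw [hsym]
  ring

omit [Fintype n] in
/-- Reflection matrices are compatible with ring homomorphisms (change of scalars). [folklore] -/
theorem reflMatrix_map {S : Type*} [CommRing S] (f : R →+* S) (s : n) :
    (reflMatrix T s).map f = reflMatrix (T.map f) s := by
  ext i j
  simp only [Matrix.map_apply, reflMatrix_apply, map_sub]
  congr 1 <;> split_ifs <;> simp

/-- A matrix `A` with `Aᵀ T A = T` preserves the bilinear form `(x, y) ↦ xᵀ T y`. [folklore] -/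
theorem toBilin'_mulVec_mulVec {A : Matrix n n R} (hA : A.transpose * T * A = T) (x y : n → R) :
    Matrix.toBilin' T (A.mulVec x) (A.mulVec y) = Matrix.toBilin' T x y := by
  rw [Matrix.toBilin'_apply', Matrix.toBilin'_apply', Matrix.mulVec_mulVec, Matrix.dotProduct_mulVec,
    Matrix.vecMul_mulVec, ← Matrix.dotProduct_mulVec, ← Matrix.mul_assoc, hA]

end Literature.LinearAlgebra.Matrix
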